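import Literature.NumberTheory.GaloisRepresentations.SUnitsCoinducedKummerLayer
import Literature.NumberTheory.GaloisRepresentations.CoinducedKummerSequencePiecesSum
import Literature.RepresentationTheory.FiniteGroups.PermutationReductionPullback
import Literature.RepresentationTheory.FiniteGroups.PermutationReductionFreeAction
import Literature.RepresentationTheory.FiniteGroups.PermutationReductionOrbitDecomposition
import Literature.NumberTheory.NumberFields.InfinitePlaceTotallyComplexBase
import HarnessLib

/-!
# The equivariant Kummer class identity behind Tate's global Euler characteristic at a totally complex
# field: `[𝓗⁰(μ_p)] − [𝓗¹(μ_p)] + [𝓗²(μ_p)] = −r₂(F₀)·[𝔽_p[Δ]]` modulo the Brauer term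

Topic `NumberTheory/GaloisCohomology`; namespace `Literature.NumberTheory.GaloisCohomology`.  THEOREMS ONLY
(no definition, no named fact, no `sorry`, no instance).

SETTING (PT3-TC / F1b currency, as in `SUnitsCoinducedKummerLayer`): `K` a TOTALLY COMPLEX number field,
`S ⊇ S_p` a finite set of finite places, `N_S ≤ H ≤ Γ_K` open, `U := galoisGroupAbove S H ≤ G_{K,S}`,
`F₀ := baseField H`, `E : GalLayer K` with `F₀ ≤ E ⊆ K_S`, `W := Gal(K_S/E) = layerSubgroup …` (open normal
in `↥U`), `Δ := ↥U ⧸ W ≃* Gal(E/F₀)` (`layerEquiv`); `E_S|_U := resRep K S H`, `μ_p := E_S[p]` (its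
`p`-torsion sub-representation); `𝓗ⁿ(A) := Hⁿ(↥U, Maps(Δ, A))` with the right-translation `Δ`-action
(`coindOpenHRep`, `coindOpenInvariantsRep` in degree `0`).

MAIN THEOREM **`additive_coindOpen_mu_euler_of_brauerClass`**: for every invariant `ψ` of `ℤ[Δ]`-modules
additive on short exact sequences of finite `p`-torsion modules (the B3a-β binder pair; instance binders
of `ψ` strict-implicit, same Π-type), GIVEN the one remaining input as a hypothesis `hH2` — the Brauer
class identity `ψ(𝓗²(E_S)[p]) + ψ(𝔽_p) = ψ(𝔽_p[S_f(E)])` (NSW (8.3.11) (iii) equivariantly; route (θ) of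
the lane) — one has
`ψ(𝓗⁰(μ_p)) + ψ(𝓗²(μ_p)) + r₂(F₀) • ψ(𝔽_p[Δ]) = ψ(𝓗¹(μ_p))`.
ASSEMBLY (all inputs landed): the Kummer pieces `[𝓗⁰(μ_p)] = [E_S^W[p]]`, `[𝓗¹(μ_p)] = [E_S^W/p] + [𝓗¹(E_S)[p]]`,
`[𝓗²(μ_p)] = [𝓗¹(E_S)/p] + [𝓗²(E_S)[p]]` (`CoinducedKummerSequencePieces…`), `𝓗¹(E_S)` finite so
`[𝓗¹(E_S)/p] = [𝓗¹(E_S)[p]]` (`StableLatticeReductionFiniteTorsionAgnostic`), `E_S^W = 𝒪ˣ_{E,S}`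
(`SUnitsCoinducedKummerLayer`), the equivariant `S`-unit theorem mod `p`
`[𝒪ˣ_{E,S}/p] + [𝔽_p] = [𝒪ˣ_{E,S}[p]] + [𝔽_p[S_f(E) ⊔ S_∞(E)]]` (`EquivariantSUnitReduction`), and
`[𝔽_p[S_∞(E)]] = r₂(F₀)·[𝔽_p[Gal(E/F₀)]]` (`S_∞(E)` is a free `Gal(E/F₀)`-set over a totally complex base,
`InfinitePlaceTotallyComplexBase` + `PermutationReductionFreeAction`), pulled back along `layerEquiv`.

Lane «TATE-EPC-TC» of cell `bsd-eis` (crux `GoodLatticeBDPValue`, stmt-BirchSwinnertonDyer-19032), brick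
B8-arith ≡ B6b (Milne *ADT* I §5, proof of Thm. 5.1: `χ′(μ_p) ∈ R(Ḡ)` at a totally complex field).
HONEST FRAMING: a CONDITIONAL identity (hypothesis `hH2`); no statement of a Summit, not Tate's formula, not
the crux is proved here.

## References
* J. S. Milne, *Arithmetic Duality Theorems*, 2nd ed. (2006), I §5 (proof of Thm. 5.1). [MilneADT2006]
* J. Neukirch, A. Schmidt, K. Wingberg, *Cohomology of Number Fields*, 2nd ed. (2008), (8.3.11), (8.7.2),
  (8.7.4). [NeukirchSchmidtWingberg2008]
* J.-P. Serre, *Représentations linéaires des groupes finis* (1977), §15.2 Thm. 32. [SerreLinearRepresentations1977]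
-/

noncomputable section

open CategoryTheory Function Submodule
open NumberField IsDedekindDomain Field Topology
open scoped Pointwise

namespace Literature.NumberTheory.GaloisCohomology

open Literature.NumberTheory.GaloisRepresentations
open Literature.NumberTheory.GaloisRepresentations.SUnits
open Literature.NumberTheory.GaloisRepresentations.SUnits.Layers
open Literature.NumberTheory.GaloisRepresentations.IdeleClassBar (GalLayer)
open Literature.NumberTheory.GaloisRepresentations.LocalWeilDatum (galFixing)
open Literature.NumberTheory.IwasawaTheory.Greenberg2006 (galoisGroupAbove)
open Literature.NumberTheory.GaloisRepresentations.OpenSubgroupLayer (algOfLE isScalarTower_algOfLE baseField)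
open Literature.NumberTheory.NumberFields (EquivariantSUnit.sUnitsRepρ EquivariantSUnit.placesAbove)
open Literature.NumberTheory.NumberFields.EquivariantSUnit (additive_sUnits_reduction finite_placesAbove
  stabilizer_infinitePlace_eq_bot card_infinitePlace_eq_mul)
open Literature.RepresentationTheory.FiniteGroups.StableLatticeReduction (smul_top_le_comap torsionBy_le_comap
  Int.finite_quotient_smul_top Int.additive_quotient_eq_subrepresentation_of_finite)
open Literature.RepresentationTheory.FiniteGroups (PermutationLattice.additive_reduction_ofMulAction_sum
  PermutationLattice.additive_reduction_ofMulAction_of_free PermutationLattice.additive_reduction_regular_comp_mulEquiv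
  PermutationLattice.additive_reduction_trivial_comp)

/-! ## The class identity for `μ_p = E_S[p]` at a layer `E/F₀` -/

variable {K : Type} [Field K] [NumberField K] {S : Set (HeightOneSpectrum (𝓞 K))}
  {H : Subgroup (absoluteGaloisGroup K)}

/-- **The equivariant `S`-unit theorem mod `p` at the layer `E/F₀`, pulled back along
`layerEquiv : Δ ≃* Gal(E/F₀)` and with the archimedean places evaluated**: for every additive `ψ` of
finite `p`-torsion `ℤ[Δ]`-modules,
`ψ(𝒪ˣ_{E,S}/p) + ψ(𝔽_p) = ψ(𝒪ˣ_{E,S}[p]) + ψ(𝔽_p[S_f(E)]) + r₂(F₀) • ψ(𝔽_p[Gal(E/F₀)])`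
(B7c `additive_sUnits_reduction`; `S_∞(E)` is a free `Gal(E/F₀)`-set with `r₂(F₀)` orbits over the totally
complex `F₀`: `stabilizer_infinitePlace_eq_bot`, `card_infinitePlace_eq_mul`,
`PermutationLattice.additive_reduction_ofMulAction_of_free`).
[cite: NeukirchSchmidtWingberg2008, (8.7.2)] [cite: MilneADT2006, I §5 (proof of Thm. 5.1)] -/
theorem additive_sUnits_reduction_layer (hHo : IsOpen (H : Set (absoluteGaloisGroup K))) (hfin : S.Finite)
    (E : GalLayer K) (hF : baseField H ≤ E.1) (hS : ramificationSubgroup K S ≤ galFixing K E.1)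
    {p : ℕ} [hp : Fact p.Prime] [NumberField ↥(baseField H)] [IsTotallyComplex ↥(baseField H)]
    {A : Type*} [AddCommGroup A]
    (ψ : ∀ ⦃X : Type⦄ ⦃_ : AddCommGroup X⦄ ⦃_ : Module ℤ X⦄, Representation ℤ (↥(galoisGroupAbove S H) ⧸
        ((OpenSubgroupLayer.layerSubgroup S hHo E hF hS : OpenNormalSubgroup ↥(galoisGroupAbove S H)) :
          Subgroup ↥(galoisGroupAbove S H))) X → A)
    (hψ : ∀ ⦃X Y Z : Type⦄ [AddCommGroup X] [Module ℤ X] [AddCommGroup Y] [Module ℤ Y]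
      [AddCommGroup Z] [Module ℤ Z] (ρX : Representation ℤ (↥(galoisGroupAbove S H) ⧸
        ((OpenSubgroupLayer.layerSubgroup S hHo E hF hS : OpenNormalSubgroup ↥(galoisGroupAbove S H)) :
          Subgroup ↥(galoisGroupAbove S H))) X) (ρY : Representation ℤ (↥(galoisGroupAbove S H) ⧸
        ((OpenSubgroupLayer.layerSubgroup S hHo E hF hS : OpenNormalSubgroup ↥(galoisGroupAbove S H)) :
          Subgroup ↥(galoisGroupAbove S H))) Y)
      (ρZ : Representation ℤ (↥(galoisGroupAbove S H) ⧸
        ((OpenSubgroupLayer.layerSubgroup S hHo E hF hS : OpenNormalSubgroup ↥(galoisGroupAbove S H)) :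
          Subgroup ↥(galoisGroupAbove S H))) Z) (f : X →ₗ[ℤ] Y) (g : Y →ₗ[ℤ] Z),
      (∀ s x, f (ρX s x) = ρY s (f x)) → (∀ s y, g (ρY s y) = ρZ s (g y)) →
      Injective f → Surjective g → LinearMap.range f = LinearMap.ker g → Finite Y →
      (∀ y : Y, (p : ℤ) • y = 0) → ψ ρY = ψ ρX + ψ ρZ) :
    (letI := algOfLE hF; haveI := isScalarTower_algOfLE (K := K) hF; haveI := E.numberField;
    ψ (Representation.quotient ((EquivariantSUnit.sUnitsRepρ K S ↥(baseField H) ↥E.1).comp (OpenSubgroupLayer.layerEquiv S hHo E hF hS).toMonoidHom)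
        ((p : ℤ) • ⊤) (smul_top_le_comap _ (p : ℤ))) +
      ψ (Representation.quotient ((Representation.trivial ℤ (↥E.1 ≃ₐ[↥(baseField H)] ↥E.1) ℤ).comp (OpenSubgroupLayer.layerEquiv S hHo E hF hS).toMonoidHom)
        ((p : ℤ) • ⊤) (smul_top_le_comap _ (p : ℤ))) =
    ψ (Representation.subrepresentation ((EquivariantSUnit.sUnitsRepρ K S ↥(baseField H) ↥E.1).comp
        (OpenSubgroupLayer.layerEquiv S hHo E hF hS).toMonoidHom) (torsionBy ℤ (Additive (sUnits K S ↥E.1)) (p : ℤ)) (torsionBy_le_comap _ (p : ℤ))) +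
      (ψ (Representation.quotient ((Representation.ofMulAction ℤ (↥E.1 ≃ₐ[↥(baseField H)] ↥E.1)
          (EquivariantSUnit.placesAbove K S ↥(baseField H) ↥E.1)).comp (OpenSubgroupLayer.layerEquiv S hHo E hF hS).toMonoidHom)
          ((p : ℤ) • ⊤) (smul_top_le_comap _ (p : ℤ))) +
        InfinitePlace.nrComplexPlaces ↥(baseField H) •
          ψ (Representation.quotient ((Representation.ofMulAction ℤ (↥E.1 ≃ₐ[↥(baseField H)] ↥E.1) (↥E.1 ≃ₐ[↥(baseField H)] ↥E.1)).comp (OpenSubgroupLayer.layerEquiv S hHo E hF hS).toMonoidHom)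
            ((p : ℤ) • ⊤) (smul_top_le_comap _ (p : ℤ))))) := by
  classical
  letI := algOfLE hF
  haveI := isScalarTower_algOfLE (K := K) hF
  haveI := E.finiteDimensional
  haveI := E.isGalois
  haveI : NumberField ↥E.1 := E.numberField
  haveI : IsGalois ↥(baseField H) ↥E.1 := IsGalois.tower_top_of_isGalois K ↥(baseField H) ↥E.1
  haveI : Finite (EquivariantSUnit.placesAbove K S ↥(baseField H) ↥E.1) := finite_placesAbove hfin
  letI : Fintype (EquivariantSUnit.placesAbove K S ↥(baseField H) ↥E.1) := Fintype.ofFinite _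
  -- `ψ` pulled back to `Gal(E/F₀)`-representations along `layerEquiv`
  let ψ' : ∀ ⦃Y : Type⦄ ⦃_ : AddCommGroup Y⦄ ⦃_ : Module ℤ Y⦄,
      Representation ℤ (↥E.1 ≃ₐ[↥(baseField H)] ↥E.1) Y → A := fun Y _ _ τ => ψ (τ.comp (OpenSubgroupLayer.layerEquiv S hHo E hF hS).toMonoidHom)
  have hψ' : ∀ ⦃X Y Z : Type⦄ [AddCommGroup X] [Module ℤ X] [AddCommGroup Y] [Module ℤ Y]
      [AddCommGroup Z] [Module ℤ Z] (ρX : Representation ℤ (↥E.1 ≃ₐ[↥(baseField H)] ↥E.1) X)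
      (ρY : Representation ℤ (↥E.1 ≃ₐ[↥(baseField H)] ↥E.1) Y)
      (ρZ : Representation ℤ (↥E.1 ≃ₐ[↥(baseField H)] ↥E.1) Z) (f : X →ₗ[ℤ] Y) (g : Y →ₗ[ℤ] Z),
      (∀ s x, f (ρX s x) = ρY s (f x)) → (∀ s y, g (ρY s y) = ρZ s (g y)) →
      Injective f → Surjective g → LinearMap.range f = LinearMap.ker g → Finite Y →
      (∀ y : Y, (p : ℤ) • y = 0) → ψ' ρY = ψ' ρX + ψ' ρZ :=
    fun X Y Z _ _ _ _ _ _ ρX ρY ρZ f g hf hg hi hs he hY hpY =>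
      hψ (ρX.comp (OpenSubgroupLayer.layerEquiv S hHo E hF hS).toMonoidHom) (ρY.comp (OpenSubgroupLayer.layerEquiv S hHo E hF hS).toMonoidHom)
        (ρZ.comp (OpenSubgroupLayer.layerEquiv S hHo E hF hS).toMonoidHom) f g
        (fun s x => hf ((OpenSubgroupLayer.layerEquiv S hHo E hF hS) s) x) (fun s y => hg ((OpenSubgroupLayer.layerEquiv S hHo E hF hS) s) y) hi hs he hY hpY
  -- B7c, the disjoint-union formula and the free `Gal(E/F₀)`-set `S_∞(E)`
  have e4 := additive_sUnits_reduction (K := K) (S := S) (F := ↥(baseField H)) (E := ↥E.1) ψ' hψ' hfin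
  have e5 := PermutationLattice.additive_reduction_ofMulAction_sum ψ' hψ'
    (EquivariantSUnit.placesAbove K S ↥(baseField H) ↥E.1) (InfinitePlace ↥E.1)
  have hcard : Fintype.card (InfinitePlace ↥E.1) =
      InfinitePlace.nrComplexPlaces ↥(baseField H) * Fintype.card (↥E.1 ≃ₐ[↥(baseField H)] ↥E.1) := by
    rw [← Nat.card_eq_fintype_card (α := (↥E.1 ≃ₐ[↥(baseField H)] ↥E.1)), IsGalois.card_aut_eq_finrank,
      card_infinitePlace_eq_mul ↥(baseField H) ↥E.1, InfinitePlace.card_eq_nrRealPlaces_add_nrComplexPlaces,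
      IsTotallyComplex.nrRealPlaces_eq_zero, zero_add]
  have e6 := PermutationLattice.additive_reduction_ofMulAction_of_free ψ' hψ'
    (fun w => stabilizer_infinitePlace_eq_bot w) _ hcard
  -- combine (no `rw` across files: the permutation modules carry two `Module ℤ` instance paths)
  have e456 := e4.trans (congrArg (fun z => ψ' ((EquivariantSUnit.sUnitsRepρ K S ↥(baseField H) ↥E.1).subrepresentation
      (torsionBy ℤ (Additive (sUnits K S ↥E.1)) (p : ℤ)) (torsionBy_le_comap _ (p : ℤ))) + z)
    (e5.trans (congrArg (fun z => ψ' ((Representation.ofMulAction ℤ (↥E.1 ≃ₐ[↥(baseField H)] ↥E.1)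
      (EquivariantSUnit.placesAbove K S ↥(baseField H) ↥E.1)).quotient ((p : ℤ) • ⊤)
        (smul_top_le_comap _ (p : ℤ))) + z) e6)))
  -- read `ψ' (τ.quotient …) = ψ ((τ.quotient …).comp layerEquiv)` in the `(τ ∘ layerEquiv).quotient …` spelling
  have cQ := congrArg (fun τ => ψ τ) (quotient_comp_eq (EquivariantSUnit.sUnitsRepρ K S ↥(baseField H) ↥E.1)
    (OpenSubgroupLayer.layerEquiv S hHo E hF hS).toMonoidHom ((p : ℤ) • ⊤) (smul_top_le_comap _ (p : ℤ)) (smul_top_le_comap _ (p : ℤ)))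
  have cT := congrArg (fun τ => ψ τ) (quotient_comp_eq (Representation.trivial ℤ (↥E.1 ≃ₐ[↥(baseField H)] ↥E.1) ℤ)
    (OpenSubgroupLayer.layerEquiv S hHo E hF hS).toMonoidHom ((p : ℤ) • ⊤) (smul_top_le_comap _ (p : ℤ)) (smul_top_le_comap _ (p : ℤ)))
  have cP := congrArg (fun τ => ψ τ) (subrepresentation_comp_eq
    (EquivariantSUnit.sUnitsRepρ K S ↥(baseField H) ↥E.1) (OpenSubgroupLayer.layerEquiv S hHo E hF hS).toMonoidHom
    (torsionBy ℤ (Additive (sUnits K S ↥E.1)) (p : ℤ)) (torsionBy_le_comap _ (p : ℤ)) (torsionBy_le_comap _ (p : ℤ)))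
  have cX := congrArg (fun τ => ψ τ) (quotient_comp_eq (Representation.ofMulAction ℤ (↥E.1 ≃ₐ[↥(baseField H)] ↥E.1)
    (EquivariantSUnit.placesAbove K S ↥(baseField H) ↥E.1)) (OpenSubgroupLayer.layerEquiv S hHo E hF hS).toMonoidHom ((p : ℤ) • ⊤)
    (smul_top_le_comap _ (p : ℤ)) (smul_top_le_comap _ (p : ℤ)))
  have cR := congrArg (fun τ => ψ τ) (quotient_comp_eq (Representation.ofMulAction ℤ (↥E.1 ≃ₐ[↥(baseField H)] ↥E.1) (↥E.1 ≃ₐ[↥(baseField H)] ↥E.1))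
    (OpenSubgroupLayer.layerEquiv S hHo E hF hS).toMonoidHom ((p : ℤ) • ⊤) (smul_top_le_comap _ (p : ℤ)) (smul_top_le_comap _ (p : ℤ)))
  exact ((congrArg₂ (· + ·) cQ cT).symm.trans e456).trans
    (congrArg₂ (· + ·) cP (congrArg₂ (· + ·) cX (congrArg (InfinitePlace.nrComplexPlaces ↥(baseField H) • ·) cR)))

/-- **The equivariant Kummer class identity modulo the Brauer term** (Milne I §5, proof of Thm. 5.1, at a
totally complex field; see the module docstring for the setting and the assembly): for every additive
invariant `ψ` of finite `p`-torsion `ℤ[Δ]`-modules and every `Δ`-stable submodule `N₂ ⊆ 𝓗²(E_S)` with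
`t ∈ N₂ ↔ (p : ℤ) • t = 0`, IF `ψ(N₂) + ψ(𝔽_p) = ψ(𝔽_p[S_f(E)])` (hypothesis `hH2`, the places of `E` above
`S` with their `Gal(E/F₀)`-action pulled back along `layerEquiv`) THEN
`ψ(𝓗⁰(μ_p)) + ψ(𝓗²(μ_p)) + r₂(F₀) • ψ(𝔽_p[Δ]) = ψ(𝓗¹(μ_p))`.
[cite: MilneADT2006, I §5 (proof of Thm. 5.1)] [cite: NeukirchSchmidtWingberg2008, (8.7.4) and (8.3.11)] -/
theorem additive_coindOpen_mu_euler_of_brauerClass [IsTotallyComplex K]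
    (hHo : IsOpen (H : Set (absoluteGaloisGroup K))) (hNH : ramificationSubgroup K S ≤ H) (hfin : S.Finite)
    (E : GalLayer K) (hF : baseField H ≤ E.1) (hS : ramificationSubgroup K S ≤ galFixing K E.1)
    {p : ℕ} [hp : Fact p.Prime] (hSp : ∀ v : HeightOneSpectrum (𝓞 K), ((p : ℕ) : 𝓞 K) ∈ v.asIdeal → v ∈ S)
    [NumberField ↥(baseField H)]
    [CompactSpace ↥(galoisGroupAbove S H)] [LocallyCompactSpace ↥(galoisGroupAbove S H)]
    {A : Type*} [AddCommGroup A]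
    (ψ : ∀ ⦃X : Type⦄ ⦃_ : AddCommGroup X⦄ ⦃_ : Module ℤ X⦄,
      Representation ℤ (↥(galoisGroupAbove S H) ⧸
        ((OpenSubgroupLayer.layerSubgroup S hHo E hF hS : OpenNormalSubgroup ↥(galoisGroupAbove S H)) :
          Subgroup ↥(galoisGroupAbove S H))) X → A)
    (hψ : ∀ ⦃X Y Z : Type⦄ [AddCommGroup X] [Module ℤ X] [AddCommGroup Y] [Module ℤ Y]
      [AddCommGroup Z] [Module ℤ Z]
      (ρX : Representation ℤ (↥(galoisGroupAbove S H) ⧸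
        ((OpenSubgroupLayer.layerSubgroup S hHo E hF hS : OpenNormalSubgroup ↥(galoisGroupAbove S H)) :
          Subgroup ↥(galoisGroupAbove S H))) X)
      (ρY : Representation ℤ (↥(galoisGroupAbove S H) ⧸
        ((OpenSubgroupLayer.layerSubgroup S hHo E hF hS : OpenNormalSubgroup ↥(galoisGroupAbove S H)) :
          Subgroup ↥(galoisGroupAbove S H))) Y)
      (ρZ : Representation ℤ (↥(galoisGroupAbove S H) ⧸
        ((OpenSubgroupLayer.layerSubgroup S hHo E hF hS : OpenNormalSubgroup ↥(galoisGroupAbove S H)) :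
          Subgroup ↥(galoisGroupAbove S H))) Z) (f : X →ₗ[ℤ] Y) (g : Y →ₗ[ℤ] Z),
      (∀ s x, f (ρX s x) = ρY s (f x)) → (∀ s y, g (ρY s y) = ρZ s (g y)) →
      Injective f → Surjective g → LinearMap.range f = LinearMap.ker g → Finite Y →
      (∀ y : Y, (p : ℤ) • y = 0) → ψ ρY = ψ ρX + ψ ρZ)
    (N₂ : Submodule ℤ (continuousCohomology 2 ((resRep K S H).coindOpen
      ((OpenSubgroupLayer.layerSubgroup S hHo E hF hS : OpenNormalSubgroup ↥(galoisGroupAbove S H)) :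
        Subgroup ↥(galoisGroupAbove S H)) (OpenSubgroupLayer.layerSubgroup S hHo E hF hS).isOpen').toTopRep))
    (hN₂ : ∀ t, t ∈ N₂ ↔ (p : ℤ) • t = 0)
    (hN₂st : ∀ c, N₂ ≤ N₂.comap ((resRep K S H).coindOpenHRep
      ((OpenSubgroupLayer.layerSubgroup S hHo E hF hS : OpenNormalSubgroup ↥(galoisGroupAbove S H)) :
        Subgroup ↥(galoisGroupAbove S H)) (OpenSubgroupLayer.layerSubgroup S hHo E hF hS).isOpen' 2 c))
    (hH2 : ψ (((resRep K S H).coindOpenHRep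
        ((OpenSubgroupLayer.layerSubgroup S hHo E hF hS : OpenNormalSubgroup ↥(galoisGroupAbove S H)) :
          Subgroup ↥(galoisGroupAbove S H)) (OpenSubgroupLayer.layerSubgroup S hHo E hF hS).isOpen' 2).subrepresentation
          N₂ hN₂st) +
      ψ ((Representation.trivial ℤ (↥(galoisGroupAbove S H) ⧸
        ((OpenSubgroupLayer.layerSubgroup S hHo E hF hS : OpenNormalSubgroup ↥(galoisGroupAbove S H)) :
          Subgroup ↥(galoisGroupAbove S H))) ℤ).quotient ((p : ℤ) • ⊤) (smul_top_le_comap _ (p : ℤ))) =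
      (letI := algOfLE hF; haveI := isScalarTower_algOfLE (K := K) hF; haveI := E.numberField;
        ψ (Representation.quotient ((Representation.ofMulAction ℤ (↥E.1 ≃ₐ[↥(baseField H)] ↥E.1)
          (EquivariantSUnit.placesAbove K S ↥(baseField H) ↥E.1)).comp
          (OpenSubgroupLayer.layerEquiv S hHo E hF hS).toMonoidHom) ((p : ℤ) • ⊤) (smul_top_le_comap _ (p : ℤ))))) :
    ψ (((resRep K S H).subrepresentation (torsionBy ℤ _ (p : ℤ))
          (torsionBy_le_comap (resRep K S H).toRepresentation (p : ℤ))).coindOpenInvariantsRep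
        ((OpenSubgroupLayer.layerSubgroup S hHo E hF hS : OpenNormalSubgroup ↥(galoisGroupAbove S H)) :
          Subgroup ↥(galoisGroupAbove S H)) (OpenSubgroupLayer.layerSubgroup S hHo E hF hS).isOpen') +
      ψ (((resRep K S H).subrepresentation (torsionBy ℤ _ (p : ℤ))
          (torsionBy_le_comap (resRep K S H).toRepresentation (p : ℤ))).coindOpenHRep
        ((OpenSubgroupLayer.layerSubgroup S hHo E hF hS : OpenNormalSubgroup ↥(galoisGroupAbove S H)) :
          Subgroup ↥(galoisGroupAbove S H)) (OpenSubgroupLayer.layerSubgroup S hHo E hF hS).isOpen' 2) +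
      InfinitePlace.nrComplexPlaces ↥(baseField H) •
        ψ ((Representation.ofMulAction ℤ (↥(galoisGroupAbove S H) ⧸
          ((OpenSubgroupLayer.layerSubgroup S hHo E hF hS : OpenNormalSubgroup ↥(galoisGroupAbove S H)) :
            Subgroup ↥(galoisGroupAbove S H))) (↥(galoisGroupAbove S H) ⧸
          ((OpenSubgroupLayer.layerSubgroup S hHo E hF hS : OpenNormalSubgroup ↥(galoisGroupAbove S H)) :
            Subgroup ↥(galoisGroupAbove S H)))).quotient ((p : ℤ) • ⊤) (smul_top_le_comap _ (p : ℤ))) =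
    ψ (((resRep K S H).subrepresentation (torsionBy ℤ _ (p : ℤ))
          (torsionBy_le_comap (resRep K S H).toRepresentation (p : ℤ))).coindOpenHRep
        ((OpenSubgroupLayer.layerSubgroup S hHo E hF hS : OpenNormalSubgroup ↥(galoisGroupAbove S H)) :
          Subgroup ↥(galoisGroupAbove S H)) (OpenSubgroupLayer.layerSubgroup S hHo E hF hS).isOpen' 1) := by
  classical
  -- instances on the layer
  letI := algOfLE hF
  haveI := isScalarTower_algOfLE (K := K) hF
  haveI := E.finiteDimensional
  haveI := E.isGalois
  haveI : NumberField ↥E.1 := E.numberField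
  haveI : IsGalois ↥(baseField H) ↥E.1 := IsGalois.tower_top_of_isGalois K ↥(baseField H) ↥E.1
  haveI : IsTotallyComplex ↥(baseField H) := isTotallyComplex_of_algebra (F := K) ↥(baseField H)
  haveI : Finite (EquivariantSUnit.placesAbove K S ↥(baseField H) ↥E.1) := finite_placesAbove hfin
  letI : Fintype (EquivariantSUnit.placesAbove K S ↥(baseField H) ↥E.1) := Fintype.ofFinite _
  have hW : IsOpen (((OpenSubgroupLayer.layerSubgroup S hHo E hF hS : OpenNormalSubgroup ↥(galoisGroupAbove S H)) :
        Subgroup ↥(galoisGroupAbove S H)) : Set ↥(galoisGroupAbove S H)) := (OpenSubgroupLayer.layerSubgroup S hHo E hF hS).isOpen'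
  haveI : DiscreteTopology (↥(galoisGroupAbove S H) ⧸ ((OpenSubgroupLayer.layerSubgroup S hHo E hF hS : OpenNormalSubgroup ↥(galoisGroupAbove S H)) :
        Subgroup ↥(galoisGroupAbove S H)) →
      Representation.invariants ((sUnitsModule K S).toRepresentation.comp (ramificationSubgroup K S).subtype)) :=
    ContinuousRep.discreteTopology_coindOpen _ hW
  haveI : DiscreteTopology (↥(galoisGroupAbove S H) ⧸ ((OpenSubgroupLayer.layerSubgroup S hHo E hF hS : OpenNormalSubgroup ↥(galoisGroupAbove S H)) :
        Subgroup ↥(galoisGroupAbove S H)) →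
      torsionBy ℤ (Representation.invariants ((sUnitsModule K S).toRepresentation.comp
        (ramificationSubgroup K S).subtype)) (p : ℤ)) :=
    ContinuousRep.discreteTopology_coindOpen _ hW
  have hp0 : p ≠ 0 := hp.out.ne_zero
  -- FINITENESS of `𝓗¹(E_S)`, of the `p`-torsion of `𝓗²(E_S)`, of `E_S^W/p`, `E_S^W[p]` (FILE B)
  haveI := totallyDisconnectedSpace_above (S := S) (H := H)
  haveI := finite_continuousCohomology_one_coindOpen_layer hHo hNH hfin E hF hS
  have hTor2 := finite_torsion_continuousCohomology_two_coindOpen_layer hHo hNH hfin E hF hS hp.out.pos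
  haveI := finite_invariantsOf_layerSubgroup_quotient hHo hfin E hF hS hp.out.ne_zero
  haveI := finite_invariantsOf_layerSubgroup_torsionBy hHo hfin E hF hS hp.out.ne_zero
  haveI := moduleFinite_invariantsOf_layerSubgroup hHo hfin E hF hS
  -- the Kummer pieces summed (generic §1), `p`-divisibility of `E_S` from (A1c)
  have eK := additive_coindOpen_torsionBy_euler (resRep K S H) ((OpenSubgroupLayer.layerSubgroup S hHo E hF hS : OpenNormalSubgroup ↥(galoisGroupAbove S H)) :
        Subgroup ↥(galoisGroupAbove S H)) hW p ψ hψ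
    (zsmul_surjective_sUnitsRestricted K S hSp) hTor2 N₂ hN₂ hN₂st
  -- `E_S^W = 𝒪ˣ_{E,S}` (FILE B) and the `S`-unit theorem at the layer
  have qΛ := additive_quotientInvariants_quotient_eq_sUnitsRep hHo E hF hS ψ hψ hfin
  have tΛ := additive_quotientInvariants_torsionBy_eq_sUnitsRep hHo E hF hS ψ hψ hfin
  have e4 := additive_sUnits_reduction_layer hHo hfin E hF hS (p := p) ψ hψ
  have e7 := PermutationLattice.additive_reduction_regular_comp_mulEquiv ψ hψ (OpenSubgroupLayer.layerEquiv S hHo E hF hS)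
  have e8 := PermutationLattice.additive_reduction_trivial_comp ψ hψ (OpenSubgroupLayer.layerEquiv S hHo E hF hS).toMonoidHom
  -- first-order assembly in `A`
  have key : ∀ (r : ℕ) (H0 H1 H2 Q0 Q0' P0 P0' N2 XP R R' T T' : A),
      H0 + H2 + Q0 = H1 + P0 + N2 → Q0 = Q0' → P0 = P0' →
      Q0' + T' = P0' + (XP + r • R') → R' = R → T' = T → N2 + T = XP →
      H0 + H2 + r • R = H1 := by
    intro r H0 H1 H2 Q0 Q0' P0 P0' N2 XP R R' T T' hK hq hp4 h4 h7 h8 hX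
    rw [h7, h8, ← hq, ← hp4, ← hX] at h4
    -- h4 : Q0 + T = P0 + (N2 + T + r • R)
    have hQ : Q0 = P0 + N2 + r • R := by
      have h' : Q0 + T = (P0 + N2 + r • R) + T := by rw [h4]; abel
      exact add_right_cancel h'
    rw [hQ] at hK
    calc H0 + H2 + r • R = (H0 + H2 + (P0 + N2 + r • R)) - (P0 + N2) := by abel
      _ = (H1 + P0 + N2) - (P0 + N2) := by rw [hK]
      _ = H1 := by abel
  exact key _ _ _ _ _ _ _ _ _ _ _ _ _ _ eK qΛ tΛ e4 e7 e8 hH2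

end Literature.NumberTheory.GaloisCohomology

end
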